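import Summits.MatrixMultiplication.OmegaCensus.BoxUsefulCentreLiftCore

/-!
# ω-census, family (b3): conjecture C9 (b) — a Sylow `2`-subgroup split by an inverted `3`-element is abelian

HONEST FRAMING (pub-omega census; verbatim): lottery ticket; floor = certified bounds/negative ranges.
Census BOOKKEEPING (conjecture C9 of the cell, STRUCTURE.md §2; pub-omega kernel-l4 gen 16, task K-5, structure part): the
common final step of the two centre-lifting cases (centre index `6`, landed as `BoxUsefulCentreLift`; class `𝒞₂`, successor),
isolated.

**Theorem (`CentreLift.sylow_comm_of_dichotomy`).** Let `G` be box-useful, `a ≠ 1` an element of `3`-power order inverted by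
`s` (`s a s⁻¹ = a⁻¹`), and `P` a Sylow `2`-subgroup such that every `p ∈ P` is second-central or has `p s⁻¹`
second-central (i.e. `P ⊆ Z₂ ∪ Z₂ s`).  Then `P` is abelian.  *Proof:* second-central elements centralise `a` (odd order,
`SecondCentre.comm_of_odd`), elements of `Z₂ s` invert it; a non-commuting pair in `P` can be moved to a pair `x ∈ Z₂ s`,
`y ∈ Z₂` with `⁅y, x⁆ ≠ 1`, and `CentreLift.core` (the `D₁₈ / D₂₄` endgame) finishes.
So in the `𝒞₂`-lifting case the Sylow `2`-subgroup is abelian, which is what makes `G = C₃² ⋊ C` with `C` abelian.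
Nothing here is progress on `ω`.
-/

namespace Summit.MatrixMultiplication.OmegaCensus

open Finset ProductBoxBound
open scoped commutatorElement

namespace CentreLift

variable {G : Type*} [Group G] [Fintype G] [DecidableEq G]

/-- **A Sylow `2`-subgroup inside `Z₂ ∪ Z₂ s`, with `s` inverting a non-trivial `3`-element, is abelian** (box-useful `G`). [folklore] -/
theorem sylow_comm_of_dichotomy (hG : BoxUseful G) {a s : G} {b : ℕ} (ha : a ^ 3 ^ b = 1) (ha1 : a ≠ 1)
    (hsa : s * a * s⁻¹ = a⁻¹) (P : Sylow 2 G)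
    (hdich : ∀ p ∈ (P : Subgroup G),
      (∀ g : G, ⁅p, g⁆ ∈ Subgroup.center G) ∨ (∀ g : G, ⁅p * s⁻¹, g⁆ ∈ Subgroup.center G)) :
    ∀ p ∈ (P : Subgroup G), ∀ q ∈ (P : Subgroup G), p * q = q * p := by
  classical
  haveI : Fact (Nat.Prime 2) := ⟨Nat.prime_two⟩
  have haodd : Odd (orderOf a) := odd_orderOf_of_pow_three ha
  -- every element of `P` has `2`-power order
  have hPord : ∀ p ∈ (P : Subgroup G), ∃ i : ℕ, orderOf p = 2 ^ i := by
    intro p hp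
    obtain ⟨i, hi⟩ := IsPGroup.iff_orderOf.mp P.isPGroup' ⟨p, hp⟩
    exact ⟨i, by rw [← hi, Subgroup.orderOf_mk]⟩
  -- an element `x = k s` with `k` second-central inverts `a`
  have hinv : ∀ x : G, (∀ g : G, ⁅x * s⁻¹, g⁆ ∈ Subgroup.center G) → x * a * x⁻¹ = a⁻¹ := by
    intro x hk
    have hka : (x * s⁻¹) * a = a * (x * s⁻¹) := SecondCentre.comm_of_odd hG hk haodd
    have hka' : (x * s⁻¹) * a⁻¹ = a⁻¹ * (x * s⁻¹) := ((show Commute (x * s⁻¹) a from hka).inv_right).eq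
    calc x * a * x⁻¹ = (x * s⁻¹) * (s * a * s⁻¹) * (x * s⁻¹)⁻¹ := by group
      _ = (x * s⁻¹) * a⁻¹ * (x * s⁻¹)⁻¹ := by rw [hsa]
      _ = a⁻¹ := by rw [hka']; group
  -- the endgame for a pair `x ∈ Z₂ s`, `y ∈ Z₂ ∩ P` with `⁅y, x⁆ ≠ 1`
  have fin : ∀ x y : G, (∀ g : G, ⁅x * s⁻¹, g⁆ ∈ Subgroup.center G) → y ∈ (P : Subgroup G) →
      (∀ g : G, ⁅y, g⁆ ∈ Subgroup.center G) → ⁅y, x⁆ ≠ 1 → False := by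
    intro x y hx hyP hy hyx
    exact core hG ha ha1 (hinv x hx) (SecondCentre.comm_of_odd hG hy haodd) hy hyx (hPord y hyP)
  -- `s` itself lies in `Z₂ s`
  have hs1 : ∀ g : G, ⁅s * s⁻¹, g⁆ ∈ Subgroup.center G := by
    intro g; rw [mul_inv_cancel, commutatorElement_def]; simp
  by_contra hnc
  push Not at hnc
  obtain ⟨p₁, hp₁, p₂, hp₂, hne⟩ := hnc
  have hc12 : ⁅p₁, p₂⁆ ≠ 1 := fun h => hne ((SecondCentre.comm_eq_one_iff p₁ p₂).1 h)
  have hc21 : ⁅p₂, p₁⁆ ≠ 1 := fun h => hne ((SecondCentre.comm_eq_one_iff p₂ p₁).1 h).symm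
  rcases hdich p₁ hp₁ with h1 | h1 <;> rcases hdich p₂ hp₂ with h2 | h2
  · -- both second-central: bring in `s`
    by_cases hs1' : ⁅p₁, s⁆ = 1
    · by_cases hs2' : ⁅p₂, s⁆ = 1
      · -- `x = s p₁`, `y = p₂`: `⁅p₂, s p₁⁆ = ⁅p₂, s⁆ ⁅p₂, p₁⁆ = ⁅p₂, p₁⁆ ≠ 1`
        refine fin (s * p₁) p₂ ?_ hp₂ h2 ?_
        · intro g
          have e : s * p₁ * s⁻¹ = p₁ := by
            have := (SecondCentre.comm_eq_one_iff p₁ s).1 hs1'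
            rw [← this]; group
          rw [e]; exact h1 g
        · rw [SecondCentre.comm_mul h2, hs2', one_mul]; exact hc21
      · exact fin s p₂ hs1 hp₂ h2 hs2'
    · exact fin s p₁ hs1 hp₁ h1 hs1'
  · -- `p₁ ∈ Z₂`, `p₂ ∈ Z₂ s`
    exact fin p₂ p₁ h2 hp₁ h1 hc12
  · -- `p₁ ∈ Z₂ s`, `p₂ ∈ Z₂`
    exact fin p₁ p₂ h1 hp₂ h2 hc21
  · -- both in `Z₂ s`: `y = p₂ p₁⁻¹ ∈ Z₂`, `x = p₁`; `⁅y, p₁⁆ = ⁅p₂, p₁⁆`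
    have hy : ∀ g : G, ⁅p₂ * p₁⁻¹, g⁆ ∈ Subgroup.center G := by
      intro g
      -- `p₂ p₁⁻¹ = (p₂ s⁻¹)(p₁ s⁻¹)⁻¹`, a product of second-central elements
      have e : p₂ * p₁⁻¹ = (p₂ * s⁻¹) * (p₁ * s⁻¹)⁻¹ := by group
      rw [e]
      -- second-central elements form a subgroup: use the quotient characterisation via the centre of `G/Z`... directly:
      have hA := h2
      have hB : ∀ g : G, ⁅(p₁ * s⁻¹)⁻¹, g⁆ ∈ Subgroup.center G := by
        intro g'
        -- `⁅k⁻¹, g⁆ = k⁻¹ ⁅k, g⁆⁻¹ k`, central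
        have : ⁅(p₁ * s⁻¹)⁻¹, g'⁆ = (p₁ * s⁻¹)⁻¹ * ⁅p₁ * s⁻¹, g'⁆⁻¹ * (p₁ * s⁻¹) := by
          rw [commutatorElement_def, commutatorElement_def]; group
        rw [this]
        exact Subgroup.Normal.conj_mem' inferInstance _ (Subgroup.inv_mem _ (h1 g')) _
      -- product of two second-central elements: `⁅k₁ k₂, g⁆ = k₁ ⁅k₂, g⁆ k₁⁻¹ ⁅k₁, g⁆`
      have : ⁅(p₂ * s⁻¹) * (p₁ * s⁻¹)⁻¹, g⁆ =
          (p₂ * s⁻¹) * ⁅(p₁ * s⁻¹)⁻¹, g⁆ * (p₂ * s⁻¹)⁻¹ * ⁅p₂ * s⁻¹, g⁆ := by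
        simp only [commutatorElement_def]; group
      rw [this]
      exact Subgroup.mul_mem _ (Subgroup.Normal.conj_mem inferInstance _ (hB g) _) (hA g)
    refine fin p₁ (p₂ * p₁⁻¹) h1 (Subgroup.mul_mem _ hp₂ (Subgroup.inv_mem _ hp₁)) hy ?_
    have e : ⁅p₂ * p₁⁻¹, p₁⁆ = ⁅p₂, p₁⁆ := by rw [commutatorElement_def, commutatorElement_def]; group
    rw [e]; exact hc21

end CentreLift

end Summit.MatrixMultiplication.OmegaCensus
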